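import Literature.AlgebraicGeometry.Frobenioids.Thm42PrimaryStepsPropagation
import Literature.AlgebraicGeometry.Frobenioids.IrreducibleMorphismsCounterexample
import Literature.AlgebraicGeometry.Frobenioids.ElementaryPreFrobenioid
import HarnessLib

/-!
# Frobenioids I, Theorem 4.2 (i), sub-DAG predicate `FrdI.T42.PreservesPrimaryAt F₁ F₂ Ψ A` ("`Ψ` maps
# primary steps to or from `A₁` to primary steps"): its universal closure is false; the instance form that holds

Mochizuki, *The geometry of Frobenioids I: the general theory*, Kyushu J. Math. **62** (2008) 293–400, §4,
Theorem 4.2 (i), proof, kurims text p. 78 ll. 47–53 [cite: MochizukiFrdI2008, Thm. 4.2 (i) p.78]: for an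
equivalence `Ψ : C₁ ⥲ C₂` of Frobenioids of standard, isotropic, non-group-like type, "`Ψ` maps primary steps
to or from `A₁` to primary steps to or from `A₂`".

In the tree this sentence is the PREDICATE `FrdI.T42.PreservesPrimaryAt F₁ F₂ Ψ A` (`Thm42Sub.lean`, seat
lineage abc-iut-L1), the body-head of the sub-DAG rows L04–L07, PROVED under the hypotheses of Theorem 4.2
(`FrdI.T42.Setting F₁ F₂ Ψ`) for every object: `FrdI.T42.preservesPrimaryAt (S : Setting F₁ F₂ Ψ) (A : C₁)`
(`Thm42PrimaryStepsPropagation.lean`).  The cell's frozen FACT-LIST lists the bare predicate as row F-2396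
(class `preparatory`, kernel_closedness `parametrised`, label «model-witness: the decl is the body-head of a
PROVED 0-ary closure fact»).  Its universal closure — "EVERY equivalence between ANY two categories with ANY
pre-Frobenioid structures preserves primary steps" — is false, and this PROOF-ONLY file (abc-iut cell, block F
fact-proving wave, seat abc-iut-f-012; no definition, no instance) records the kernel census:

* `FrdI.T42.not_forall_preservesPrimaryAt` — ¬∀ over exactly the declaration's binders (universe level `0`),
  from the closed witness `not_preservesPrimaryAt_standard`: on the STANDARD Frobenioid `F_{ℤ≥0}` of [FrdI]
  Def. 1.1 (iii) (`StandardFrobenioidExample`, structure `F_Φ → F_{Φ^char}` of Prop. 1.5) take `Ψ := 𝟭` and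
  for the SECOND structure on the same category the zero-section structure `A ↦ (Base A, 0, 1)` (every arrow
  gets the zero divisor): the arrow `(id, 1, 1)` (`stepOne`) is a primary step for the first structure
  (a pre-step, not an isomorphism, with primary zero divisor `1 ∈ ℤ≥0`), while its image has zero divisor
  `0`, which is not primary.  What the witness exploits: the schema's `F₂` is a free structure functor —
  print's `Ψ` compares the Frobenioid structures THEMSELVES (Thm. 3.4); nothing is said about print.
* `FrdI.T42.preservesPrimaryAt_schema_census` — the closure is false AND the instance form holds: under
  `FrdI.T42.Setting F₁ F₂ Ψ` the predicate holds at every `A` (by name, `FrdI.T42.preservesPrimaryAt`).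

So row F-2396 is admissible only as the conclusion it already is (FACT-LIST class «universal-closure REFUTED;
instance form PROVED»).  Elementary; nothing here bears on [IUTchIII] Cor. 3.12 or takes a side; refuted-as-
closure is a statement about OUR typing's binders, not about the paper.
-/

namespace Literature.AlgebraicGeometry.Frobenioids

open CategoryTheory StandardFrobenioidExample

namespace FrdI.T42

/-! ### The witness on the standard Frobenioid -/

/-- In `ℤ≥0` (written multiplicatively) modulo units, the class of `1` is a PRIMARY element ([FrdI] §0 p. 12:
non-zero, and `≼`-below every non-zero element below it — indeed `1 ≤ b` for every `b ≠ 0`).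
[cite: MochizukiFrdI2008, §0 p.12] -/
theorem isPrimary_mk_ofAdd_one :
    IsPrimary (Associates.mk (Multiplicative.ofAdd (1 : ℕ)) : Associates M) := by
  refine ⟨fun h => ?_, fun b hb _ => ?_⟩
  · have h1 := eq_one_of_isUnit_M _ (Associates.mk_eq_one.mp h)
    exact absurd (congrArg Multiplicative.toAdd h1) (by decide)
  · obtain ⟨y, rfl⟩ := Associates.mk_surjective b
    have hy : y.toAdd ≠ 0 := fun h0 => hb (by
      rw [Multiplicative.toAdd.injective (h0.trans toAdd_one.symm), Associates.mk_one])
    refine ⟨1, Nat.one_pos, ?_⟩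
    rw [pow_one, Associates.mk_dvd_mk]
    refine ⟨Multiplicative.ofAdd (y.toAdd - 1), ?_⟩
    apply Multiplicative.toAdd.injective
    rw [toAdd_mul, toAdd_ofAdd, toAdd_ofAdd]
    omega

/-- The arrow `(id, 1, 1)` of the standard Frobenioid is a STEP (a pre-step that is not an isomorphism).
[cite: MochizukiFrdI2008, Def. 1.2 (iii) p.23] -/
theorem isStep_stepOne (X : ElemFrobenioid Φst) :
    PreFrobenioid.IsStep (ElemFrobenioid.toChar Φst) (stepOne X) := by
  refine ⟨isPreStep_stepOne X, fun h => ?_⟩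
  have h0 := dv_eq_zero_of_isIso (stepOne X)
  rw [dv_stepOne] at h0
  exact one_ne_zero h0

/-- The arrow `(id, 1, 1)` of the standard Frobenioid is a PRIMARY pre-step (its zero divisor `1 ∈ ℤ≥0` is
primary). [cite: MochizukiFrdI2008, Def. 1.2 (iii) p.23] -/
theorem isPrimaryPreStep_stepOne (X : ElemFrobenioid Φst) :
    PreFrobenioid.IsPrimaryPreStep (ElemFrobenioid.toChar Φst) (stepOne X) :=
  ⟨isPreStep_stepOne X, isPrimary_mk_ofAdd_one⟩

/-- **Closed witness**: on the standard Frobenioid, with `Ψ := 𝟭` and the zero-section structure as second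
structure, primary steps are NOT preserved at the (unique) object: `(id, 1, 1)` is a primary step whose image
has the (non-primary) zero divisor `0`. [cite: MochizukiFrdI2008, Thm. 4.2 (i) p.78] -/
theorem not_preservesPrimaryAt_standard :
    ¬ PreservesPrimaryAt (ElemFrobenioid.toChar Φst)
        (ElemFrobenioid.baseFunctor Φst ⋙ ElemFrobenioid.zeroSection (charFunctor Φst))
        (CategoryTheory.Equivalence.refl : ElemFrobenioid Φst ≌ ElemFrobenioid Φst)
        StandardFrobenioidExample.A := by
  intro h
  have hp := (h.1 (stepOne StandardFrobenioidExample.A) (isStep_stepOne _) (isPrimaryPreStep_stepOne _)).2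
  exact hp.1 rfl

/-! ### The universal closure is false; the instance form holds -/

/-- **The universal closure of the sub-DAG predicate `FrdI.T42.PreservesPrimaryAt` is FALSE** (FACT-LIST
F-2396: a body-head predicate, not a hypothesis).  Binders exactly those of the declaration, universe
level `0`. [cite: MochizukiFrdI2008, Thm. 4.2 (i) p.78] -/
theorem not_forall_preservesPrimaryAt :
    ¬ ∀ (D₁ : Type) [Category.{0} D₁] (Φ₁ : D₁ᵒᵖ ⥤ CommMonCat.{0}) (C₁ : Type) [Category.{0} C₁]
        (D₂ : Type) [Category.{0} D₂] (Φ₂ : D₂ᵒᵖ ⥤ CommMonCat.{0}) (C₂ : Type) [Category.{0} C₂]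
        (F₁ : C₁ ⥤ ElemFrobenioid Φ₁) (F₂ : C₂ ⥤ ElemFrobenioid Φ₂) (Ψ : C₁ ≌ C₂) (A : C₁),
        Literature.AlgebraicGeometry.Frobenioids.FrdI.T42.PreservesPrimaryAt F₁ F₂ Ψ A :=
  fun h => not_preservesPrimaryAt_standard (h _ _ _ _ _ _ _ _ _ _)

/-- **Census of F-2396**: the closure is false, while the instance form print asserts HOLDS — in the setting
of Theorem 4.2 (`Setting F₁ F₂ Ψ`: Frobenioids of perfect isotropic type, `Φᵢ` perf-factorial, `Ψ` an
equivalence with the Thm. 3.4 conclusions) `Ψ` preserves primary steps at EVERY object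
(`FrdI.T42.preservesPrimaryAt`). [cite: MochizukiFrdI2008, Thm. 4.2 (i) p.78] -/
theorem preservesPrimaryAt_schema_census {D₁ : Type} [Category.{0} D₁] {Φ₁ : D₁ᵒᵖ ⥤ CommMonCat.{0}}
    {C₁ : Type} [Category.{0} C₁] {D₂ : Type} [Category.{0} D₂] {Φ₂ : D₂ᵒᵖ ⥤ CommMonCat.{0}}
    {C₂ : Type} [Category.{0} C₂] {F₁ : C₁ ⥤ ElemFrobenioid Φ₁} {F₂ : C₂ ⥤ ElemFrobenioid Φ₂}
    {Ψ : C₁ ≌ C₂} (S : Setting F₁ F₂ Ψ) (A : C₁) :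
    (¬ ∀ (D₁ : Type) [Category.{0} D₁] (Φ₁ : D₁ᵒᵖ ⥤ CommMonCat.{0}) (C₁ : Type) [Category.{0} C₁]
        (D₂ : Type) [Category.{0} D₂] (Φ₂ : D₂ᵒᵖ ⥤ CommMonCat.{0}) (C₂ : Type) [Category.{0} C₂]
        (F₁ : C₁ ⥤ ElemFrobenioid Φ₁) (F₂ : C₂ ⥤ ElemFrobenioid Φ₂) (Ψ : C₁ ≌ C₂) (A : C₁),
        Literature.AlgebraicGeometry.Frobenioids.FrdI.T42.PreservesPrimaryAt F₁ F₂ Ψ A) ∧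
      PreservesPrimaryAt F₁ F₂ Ψ A :=
  ⟨not_forall_preservesPrimaryAt, preservesPrimaryAt S A⟩

end FrdI.T42

end Literature.AlgebraicGeometry.Frobenioids
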